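import Mathlib
import Literature.Analysis.FunctionSpaces.LaplaceFourierSliceLaplace
import Literature.MeasureTheory.Radon.BimeasureExtension
import Literature.MeasureTheory.Integral.LaplaceUniqueSigmaFinite
import HarnessLib

/-!
# The Laplace–Fourier measure of a positive-definite function on the `*`-semigroup `(0,∞) × V`

**Theorem** (`exists_laplaceFourierMeasure`).  Let `V` be a finite-dimensional real inner product space and
`k : ℝ → V → ℝ` positive definite on the `*`-semigroup `((0,∞) × V, +, (t,z)* = (t,−z))` in real form
(`∑ cᵢcⱼ k(tᵢ+tⱼ)(zᵢ−zⱼ) ≥ 0`), even and continuous in `z`, with `t ↦ k t 0` bounded on every `[t₀,∞)`.  Then there is ONE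
positive measure `μ` on `ℝ × V`, carried by `E ≥ 0`, with `∫ e^{-tE} dμ < ∞` and
`k t z = ∫ e^{-tE} cos⟪q, z⟫ dμ(E, q)` for all `t > 0`, `z ∈ V` [cite: GlimmJaffeQP1987, §6.2 (Källén–Lehmann representation
of reflection-positive two-point functions)], [cite: BergChristensenRessel1984, Ch. 4 §4].

Assembly of the tree's pieces: Bochner slices `m_t` (`exists_bochnerSlice`), per-set Laplace measures `λ_B`
(`exists_measure_laplace_bochnerSlice_apply`), the tilted finite bimeasure `e^{-E}λ_B` (additivity and σ-additivity in `B` by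
σ-finite Laplace uniqueness `measure_eq_of_lintegral_laplace_eq`), its extension to a measure on `ℝ × V`
(`exists_measure_prod_eq_bimeasure`, Marczewski), untilting by `e^{E}`, and the read-out of the slices.
THEOREMS ONLY; no `sorry`; standard axioms.  Motivation: stub `stub_laplaceFourier` of LINE g18-A on crux
⟨stmt-QuantumFields-23125⟩ (the Summits instantiation `k t z = K(t, z⃗)` is separate).
-/

noncomputable section

open MeasureTheory Complex Set Filter Topology Function
open scoped ComplexConjugate InnerProductSpace NNReal ENNReal

namespace Literature.Analysis.FunctionSpaces

open Literature.MeasureTheory.Integral Literature.MeasureTheory.Radon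

variable {V : Type*} [NormedAddCommGroup V] [InnerProductSpace ℝ V] [FiniteDimensional ℝ V]
  [MeasurableSpace V] [BorelSpace V]

/-- **The Laplace–Fourier measure.**  See the module docstring. [cite: GlimmJaffeQP1987, §6.2]
[cite: BergChristensenRessel1984, Ch. 4 §4] -/
theorem exists_laplaceFourierMeasure {k : ℝ → V → ℝ}
    (hPD : ∀ (m : ℕ) (t : Fin m → ℝ) (z : Fin m → V) (c : Fin m → ℝ), (∀ i, 0 < t i) →
      0 ≤ ∑ i, ∑ j, c i * c j * k (t i + t j) (z i - z j))
    (heven : ∀ t z, k t (-z) = k t z) (hcont : ∀ t, 0 < t → Continuous (k t))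
    (hbdd : ∀ t₀ : ℝ, 0 < t₀ → ∃ M : ℝ, ∀ t : ℝ, t₀ ≤ t → k t 0 ≤ M) :
    ∃ μ : Measure (ℝ × V), μ (Iio 0 ×ˢ univ) = 0 ∧ ∀ t : ℝ, 0 < t →
      Integrable (fun p : ℝ × V => Real.exp (-(t * p.1))) μ ∧
      ∀ z : V, k t z = ∫ p : ℝ × V, Real.exp (-(t * p.1)) * Real.cos ⟪p.2, z⟫_ℝ ∂μ := by
  classical
  haveI : PolishSpace V := by infer_instance
  -- Bochner slices
  have hsl : ∀ t : ℝ, ∃ m : Measure V, 0 < t → IsFiniteMeasure m ∧ ∀ z, charFun m z = k t z := by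
    intro t
    by_cases ht : 0 < t
    · obtain ⟨m, hm⟩ := exists_bochnerSlice hPD heven hcont ht
      exact ⟨m, fun _ => hm⟩
    · exact ⟨0, fun h => absurd h ht⟩
  choose m hm using hsl
  -- per-set Laplace measures
  have hlamex : ∀ B : Set V, ∃ lamB : Measure ℝ, lamB (Iio 0) = 0 ∧ ∀ t : ℝ, 0 < t →
      Integrable (fun E => Real.exp (-(t * E))) lamB ∧ ((m t) B).toReal = ∫ E, Real.exp (-(t * E)) ∂lamB :=
    fun B => exists_measure_laplace_bochnerSlice_apply hPD hbdd hm B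
  choose lam hlam0 hlam using hlamex
  -- Laplace transforms in `ℝ≥0∞` currency
  have hL : ∀ (B : Set V) (t : ℝ), 0 < t →
      ∫⁻ E, ENNReal.ofReal (Real.exp (-(t * E))) ∂(lam B) = (m t) B := by
    intro B t ht
    haveI := (hm t ht).1
    obtain ⟨hint, hrep⟩ := hlam B t ht
    rw [← ofReal_integral_eq_lintegral_ofReal hint (ae_of_all _ fun E => (Real.exp_pos _).le), ← hrep,
      ENNReal.ofReal_toReal (measure_ne_top _ _)]
  have hL1 : ∀ B : Set V, ∫⁻ E, ENNReal.ofReal (Real.exp (-E)) ∂(lam B) ≠ ∞ := by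
    intro B
    have := hL B 1 one_pos
    simp only [one_mul] at this
    rw [this]
    haveI := (hm 1 one_pos).1
    exact measure_ne_top _ _
  -- uniqueness tool: a measure on `[0,∞)` with the Laplace transform of `lam B` is `lam B`
  have huniq : ∀ (B : Set V) (ν : Measure ℝ), ν (Iio 0) = 0 →
      (∀ t : ℝ, 0 < t → ∫⁻ E, ENNReal.ofReal (Real.exp (-(t * E))) ∂ν = (m t) B) → ν = lam B := by
    intro B ν hν0 hν
    have hν1 : ∫⁻ E, ENNReal.ofReal (Real.exp (-E)) ∂ν ≠ ∞ := by
      have := hν 1 one_pos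
      simp only [one_mul] at this
      rw [this]
      haveI := (hm 1 one_pos).1
      exact measure_ne_top _ _
    exact measure_eq_of_lintegral_laplace_eq hν0 (hlam0 B) hν1 (hL1 B) fun t ht => by rw [hν t ht, hL B t ht]
  -- the tilted finite bimeasure `lam' B = e^{-E} λ_B`
  set ρ : ℝ → ℝ≥0∞ := fun E => ENNReal.ofReal (Real.exp (-E)) with hρ
  have hρm : Measurable ρ := (measurable_id.neg.exp).ennreal_ofReal
  set lam' : Set V → Measure ℝ := fun B => (lam B).withDensity ρ with hlam'
  have hfin' : ∀ B, IsFiniteMeasure (lam' B) := fun B =>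
    ⟨by rw [hlam', withDensity_apply _ MeasurableSet.univ, Measure.restrict_univ]; exact lt_top_iff_ne_top.2 (hL1 B)⟩
  -- `λ_∅ = 0`
  have hlam_empty : lam ∅ = 0 := by
    refine (huniq ∅ 0 (by simp) fun t ht => ?_).symm
    simp
  have h0' : lam' ∅ = 0 := by rw [hlam']; dsimp only; rw [hlam_empty, withDensity_zero_left]
  -- additivity in `B`
  have hadd : ∀ B B', MeasurableSet B → MeasurableSet B' → Disjoint B B' → lam (B ∪ B') = lam B + lam B' := by
    intro B B' hB hB' hdis
    refine (huniq (B ∪ B') (lam B + lam B') ?_ fun t ht => ?_).symm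
    · rw [Measure.add_apply, hlam0, hlam0, add_zero]
    · rw [lintegral_add_measure, hL B t ht, hL B' t ht, measure_union hdis hB']
  have hadd' : ∀ B B', MeasurableSet B → MeasurableSet B' → Disjoint B B' → lam' (B ∪ B') = lam' B + lam' B' := by
    intro B B' hB hB' hdis
    rw [hlam']; dsimp only; rw [hadd B B' hB hB' hdis, withDensity_add_measure]
  -- σ-additivity in `B`
  have hσ : ∀ (f : ℕ → Set V), (∀ i, MeasurableSet (f i)) → Pairwise (Disjoint on f) →
      lam (⋃ i, f i) = Measure.sum (fun i => lam (f i)) := by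
    intro f hf hdis
    refine (huniq (⋃ i, f i) (Measure.sum fun i => lam (f i)) ?_ fun t ht => ?_).symm
    · rw [Measure.sum_apply _ measurableSet_Iio]
      simp [hlam0]
    · rw [lintegral_sum_measure, measure_iUnion hdis hf]
      exact tsum_congr fun i => hL (f i) t ht
  have hσ' : ∀ A, MeasurableSet A → ∀ (f : ℕ → Set V), (∀ i, MeasurableSet (f i)) → Pairwise (Disjoint on f) →
      lam' (⋃ i, f i) A = ∑' i, lam' (f i) A := by
    intro A hA f hf hdis
    rw [hlam']; dsimp only
    rw [hσ f hf hdis, withDensity_sum, Measure.sum_apply _ hA]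
  -- the product measure of the tilted bimeasure, and the untilted `μ`
  obtain ⟨μ', hμ'⟩ := exists_measure_prod_eq_bimeasure (X := ℝ) (Y := V) lam' hfin' h0' hadd' hσ'
  set ρ' : ℝ × V → ℝ≥0∞ := fun p => ENNReal.ofReal (Real.exp p.1) with hρ'
  have hρ'm : Measurable ρ' := (measurable_fst.exp).ennreal_ofReal
  refine ⟨μ'.withDensity ρ', ?_, fun t ht => ?_⟩
  · -- carried by `E ≥ 0`
    refine withDensity_absolutelyContinuous _ _ ?_
    rw [hμ' _ _ measurableSet_Iio MeasurableSet.univ, hlam']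
    dsimp only
    exact withDensity_absolutelyContinuous _ _ (hlam0 univ)
  · haveI := (hm t ht).1
    -- the `E`-marginal of `μ'` above `B` is `lam' B`
    have hmarg : ∀ B : Set V, MeasurableSet B →
        (μ'.restrict (univ ×ˢ B)).map Prod.fst = lam' B := by
      intro B hB
      haveI := hfin' B
      refine Measure.ext fun A hA => ?_
      rw [Measure.map_apply measurable_fst hA, Measure.restrict_apply (measurable_fst hA),
        show Prod.fst ⁻¹' A ∩ univ ×ˢ B = A ×ˢ B by ext ⟨x, y⟩; simp, hμ' A B hA hB]
    -- the Laplace weight `e^{-tE}` as an `ℝ≥0`-valued density on `ℝ × V`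
    set g : ℝ × V → ℝ≥0 := fun p => (Real.exp (-(t * p.1))).toNNReal with hg
    have hgm : Measurable g := ((measurable_fst.const_mul t).neg.exp).real_toNNReal
    have hgcoe : ∀ p : ℝ × V, (g p : ℝ≥0∞) = ENNReal.ofReal (Real.exp (-(t * p.1))) := fun p => rfl
    -- the weight integrates over `μ` above `B` to `m_t(B)`
    have hslice : ∀ B : Set V, MeasurableSet B →
        ∫⁻ p in univ ×ˢ B, (g p : ℝ≥0∞) ∂(μ'.withDensity ρ') = (m t) B := by
      intro B hB
      have hGm : Measurable fun E : ℝ => ENNReal.ofReal (Real.exp ((1 - t) * E)) :=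
        ((measurable_id.const_mul (1 - t)).exp).ennreal_ofReal
      rw [setLIntegral_withDensity_eq_setLIntegral_mul _ hρ'm hgm.coe_nnreal_ennreal (MeasurableSet.univ.prod hB)]
      have e1 : (ρ' * fun p => (g p : ℝ≥0∞)) = fun p : ℝ × V => ENNReal.ofReal (Real.exp ((1 - t) * p.1)) := by
        funext p
        simp only [Pi.mul_apply, hρ', hgcoe]
        rw [← ENNReal.ofReal_mul (Real.exp_pos _).le, ← Real.exp_add]
        congr 2; ring
      rw [e1, show (∫⁻ p in univ ×ˢ B, ENNReal.ofReal (Real.exp ((1 - t) * p.1)) ∂μ') =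
          ∫⁻ E, ENNReal.ofReal (Real.exp ((1 - t) * E)) ∂((μ'.restrict (univ ×ˢ B)).map Prod.fst) by
        rw [lintegral_map hGm measurable_fst], hmarg B hB, hlam']
      dsimp only
      rw [lintegral_withDensity_eq_lintegral_mul _ hρm hGm, ← hL B t ht]
      refine lintegral_congr fun E => ?_
      simp only [Pi.mul_apply, hρ]
      rw [← ENNReal.ofReal_mul (Real.exp_pos _).le, ← Real.exp_add]
      congr 2; ring
    -- the `q`-marginal of `e^{-tE} μ` is the Bochner slice `m_t`
    set ν : Measure V := ((μ'.withDensity ρ').withDensity fun p => (g p : ℝ≥0∞)).map Prod.snd with hν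
    have hνB : ∀ B : Set V, MeasurableSet B → ν B = (m t) B := by
      intro B hB
      rw [hν, Measure.map_apply measurable_snd hB, withDensity_apply _ (measurable_snd hB),
        show (Prod.snd ⁻¹' B : Set (ℝ × V)) = univ ×ˢ B by ext ⟨x, y⟩; simp]
      exact hslice B hB
    have hνm : ν = m t := Measure.ext fun B hB => hνB B hB
    haveI : IsFiniteMeasure ν := by rw [hνm]; infer_instance
    -- integrability of the weight
    have hlint : ∫⁻ p, (g p : ℝ≥0∞) ∂(μ'.withDensity ρ') = (m t) univ := by
      rw [← setLIntegral_univ, ← univ_prod_univ]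
      exact hslice univ MeasurableSet.univ
    have hint : Integrable (fun p : ℝ × V => Real.exp (-(t * p.1))) (μ'.withDensity ρ') := by
      refine ⟨by fun_prop, ?_⟩
      rw [hasFiniteIntegral_iff_ofReal (ae_of_all _ fun p => (Real.exp_pos _).le)]
      simp_rw [← hgcoe]
      rw [hlint]
      exact measure_lt_top _ _
    refine ⟨hint, fun z => ?_⟩
    -- read-out of the slice
    have hcosint : ∫ p, Real.exp (-(t * p.1)) * Real.cos ⟪p.2, z⟫_ℝ ∂(μ'.withDensity ρ') =
        ∫ q, Real.cos ⟪q, z⟫_ℝ ∂ν := by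
      rw [hν, integral_map measurable_snd.aemeasurable (by fun_prop), integral_withDensity_eq_integral_smul hgm]
      refine integral_congr_ae (ae_of_all _ fun p => ?_)
      simp only [hg, NNReal.smul_def, smul_eq_mul, Real.coe_toNNReal _ (Real.exp_pos _).le]
    rw [hcosint, hνm]
    -- `∫ cos⟪q,z⟫ dm_t = Re (charFun m_t z) = k t z`
    have hre : (charFun (m t) z).re = ∫ q, Real.cos ⟪q, z⟫_ℝ ∂(m t) := by
      have hI : Integrable (fun q : V => Complex.exp (⟪q, z⟫_ℝ * I)) (m t) := by
        refine (integrable_const (1 : ℝ)).mono' (by fun_prop) (ae_of_all _ fun q => ?_)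
        rw [Complex.norm_exp_ofReal_mul_I]
      have h2 := integral_re hI
      simp only [RCLike.re_to_complex, Complex.exp_ofReal_mul_I_re] at h2
      rw [charFun_apply, ← h2]
    rw [← hre, (hm t ht).2 z, Complex.ofReal_re]

end Literature.Analysis.FunctionSpaces

end
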